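import Mathlib.Data.Nat.Factorial.Basic
import Mathlib.Data.Nat.Choose.Basic
import Mathlib.Data.Fintype.BigOperators
import Mathlib.Data.Fintype.Powerset
import Mathlib.Data.Fintype.Sigma
import Mathlib.Algebra.Order.BigOperators.Group.Finset
import Mathlib.Tactic.Linarith
import Mathlib.Tactic.Ring
import Mathlib.Tactic.NormNum
import Mathlib.Tactic.Positivity
import Literature.Computability.QuantumComplexity.GaussianRank

/-!
# Crux `SpinorFlattening.NegApproxGaussRankSuperpoly` (stmt-QuantumAdvantage-1245) — stub `stub_countGap`

Line `spectral-mass-flattening`, stub `stub_countGap` (COUNTING): for every exponent `c` there are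
`t, K` with
  `2 (t^c + c) · D_K(4t) < |𝔉_K|`,
where `𝔉_K = {s : Fin t → Option (Fin 4 × Bool) // s excites exactly K blocks}` is the degree-`K`
flat family of block patterns and `D_K(N) = flatteningDeficiency K N = Σ_{j ≤ K, j ≡ K (2)} C(N, j)`
is the normal-ordering deficiency.

Proof (elementary counting, witnesses `i = 2^(2c+10)`, `K = 2i`, `t = 8i`):
* `|𝔉_K| ≥ C(t,K) · 8^K`: the pairs (`K`-subset `B ⊆ Fin t`, labelling `B → Fin 4 × Bool`) inject
  into `𝔉_K` (`countGap_choose_mul_pow_le_card`);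
* `D_K(4t) ≤ (K+1) · C(4t,K)` for `K ≤ 2t`: at most `K+1` terms, each `C(4t,j) ≤ C(4t,K)` because
  the binomial coefficients increase below the middle (`countGap_deficiency_le`);
* multiply by `K!`: `K! · C(m,K) = m (m-1) ⋯ (m-K+1)` lies between `(m+1-K)^K` and `m^K`, so
  `K! · D_K(4t) ≤ (K+1) (4t)^K = (2i+1) (32 i)^(2i)` and `K! · |𝔉_K| ≥ (t+1-K)^K 8^K ≥ (48 i)^(2i)`;
* hence it suffices that `2 (t^c + c) (2i+1) · 32^(2i) < 48^(2i)`, which follows from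
  `2 (t^c + c)(2i+1) < 2^i` (as `2^i · 1024^i = 2048^i ≤ 2304^i`), and the latter is exponent
  bookkeeping in base `2`: `2 ((8i)^c + c)(2i+1) < 2^((a+3)c + a + 4) ≤ 2^(2^a)` for `a = 2c + 10`.
-/

namespace Summit.QuantumAdvantage.QuantumAdvantage.Theorems.SpinorFlattening

open Matrix Finset
open Literature.Computability.QuantumComplexity Literature.Computability.Cryptography

/-! ## The flat family has at least `C(t,K) · 8^K` members -/

/-- The block pattern with excitation set `B` and labels `f` (`some (f b)` on `B`, `none` off `B`)
excites exactly the blocks of `B`. -/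
theorem countGap_pattern_support {t : ℕ} (B : Finset (Fin t)) (f : B → Fin 4 × Bool) :
    (univ.filter fun b => (if h : b ∈ B then some (f ⟨b, h⟩) else none).isSome) = B := by
  ext b
  simp only [Finset.mem_filter, Finset.mem_univ, true_and]
  by_cases h : b ∈ B
  · simp [h]
  · simp [h]

/-- The pairs (`K`-subset `B ⊆ Fin t`, labelling `B → Fin 4 × Bool`) number `C(t,K) · 8^K`. -/
theorem countGap_card_sigma (t K : ℕ) :
    Fintype.card (Σ B : {B : Finset (Fin t) // B.card = K}, (B.1 → Fin 4 × Bool)) =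
      t.choose K * 8 ^ K := by
  rw [Fintype.card_sigma]
  have h : ∀ B : {B : Finset (Fin t) // B.card = K},
      Fintype.card (B.1 → Fin 4 × Bool) = 8 ^ K := by
    intro B
    rw [Fintype.card_fun, Fintype.card_prod, Fintype.card_fin, Fintype.card_bool, Fintype.card_coe,
      B.2]
  simp_rw [h]
  rw [Finset.sum_const, Finset.card_univ, Fintype.card_finset_len, Fintype.card_fin, smul_eq_mul]

/-- FAMILY COUNT: `C(t,K) · 8^K ≤ |𝔉_K|` — the map (`K`-subset `B`, labelling `f : B → Fin 4 × Bool`) ↦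
(the pattern `some (f b)` on `B`, `none` off `B`) lands in `𝔉_K` and is injective (the pattern determines
its excitation set and its labels). -/
theorem countGap_choose_mul_pow_le_card (t K : ℕ) :
    t.choose K * 8 ^ K ≤ Fintype.card {s : Fin t → Option (Fin 4 × Bool) //
      (univ.filter fun b => (s b).isSome).card = K} := by
  rw [← countGap_card_sigma]
  refine Fintype.card_le_of_injective
    (fun p => ⟨fun b => if h : b ∈ p.1.1 then some (p.2 ⟨b, h⟩) else none,
      by rw [countGap_pattern_support]; exact p.1.2⟩) ?_
  rintro ⟨⟨B, hB⟩, f⟩ ⟨⟨B', hB'⟩, f'⟩ h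
  have h' : (fun b => if h : b ∈ B then some (f ⟨b, h⟩) else none) =
      fun b => if h : b ∈ B' then some (f' ⟨b, h⟩) else none := congrArg Subtype.val h
  have hBB : B = B' := by
    ext b
    have hb : (if h : b ∈ B then some (f ⟨b, h⟩) else none) =
        if h : b ∈ B' then some (f' ⟨b, h⟩) else none := congrFun h' b
    constructor
    · intro h1
      by_contra h2
      rw [dif_pos h1, dif_neg h2] at hb
      exact Option.some_ne_none _ hb
    · intro h2
      by_contra h1
      rw [dif_neg h1, dif_pos h2] at hb
      exact Option.some_ne_none _ hb.symm
  subst hBB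
  have hff : f = f' := by
    funext x
    obtain ⟨b, hb⟩ := x
    have hx : (if h : b ∈ B then some (f ⟨b, h⟩) else none) =
        if h : b ∈ B then some (f' ⟨b, h⟩) else none := congrFun h' b
    rw [dif_pos hb, dif_pos hb, Option.some.injEq] at hx
    exact hx
  subst hff
  rfl

/-! ## The deficiency has at most `K + 1` terms, each at most `C(N,K)` -/

/-- Below the middle the binomial coefficients increase: `C(N,j) ≤ C(N,K)` for `j ≤ K ≤ N/2`. -/
theorem countGap_choose_le_choose (N j : ℕ) :
    ∀ K : ℕ, j ≤ K → K ≤ N / 2 → N.choose j ≤ N.choose K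
  | 0, hj, _ => by rw [Nat.le_zero.mp hj]
  | K + 1, hj, hK => by
      rcases Nat.lt_or_eq_of_le hj with h | h
      · exact (countGap_choose_le_choose N j K (Nat.lt_succ_iff.mp h) (by omega)).trans
          (Nat.choose_le_succ_of_lt_half_left (by omega))
      · rw [h]

/-- DEFICIENCY BOUND: `D_K(N) ≤ (K+1) · C(N,K)` for `K ≤ N/2`. -/
theorem countGap_deficiency_le {K N : ℕ} (hK : K ≤ N / 2) :
    flatteningDeficiency K N ≤ (K + 1) * N.choose K := by
  rw [flatteningDeficiency_eq]
  calc ∑ j ∈ (Finset.range (K + 1)).filter (fun j => j % 2 = K % 2), N.choose j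
      ≤ ∑ j ∈ Finset.range (K + 1), N.choose j :=
        Finset.sum_le_sum_of_subset_of_nonneg (Finset.filter_subset _ _) fun _ _ _ => Nat.zero_le _
    _ ≤ (Finset.range (K + 1)).card • N.choose K :=
        Finset.sum_le_card_nsmul _ _ _ fun j hj =>
          countGap_choose_le_choose N j K (Nat.lt_succ_iff.mp (Finset.mem_range.mp hj)) hK
    _ = (K + 1) * N.choose K := by rw [Finset.card_range, smul_eq_mul]

/-! ## Clearing the factorials -/

/-- `K! · D_K(4t) ≤ (K+1) · (4t)^K` for `K ≤ 2t` (`K! C(m,K) = m.descFactorial K ≤ m^K`). -/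
theorem countGap_factorial_mul_deficiency_le {t K : ℕ} (hK : K ≤ 2 * t) :
    K.factorial * flatteningDeficiency K (t * 4) ≤ (K + 1) * (t * 4) ^ K := by
  calc K.factorial * flatteningDeficiency K (t * 4)
      ≤ K.factorial * ((K + 1) * (t * 4).choose K) :=
        Nat.mul_le_mul_left _ (countGap_deficiency_le (by omega))
    _ = (K + 1) * (t * 4).descFactorial K := by
        rw [Nat.descFactorial_eq_factorial_mul_choose]; ring
    _ ≤ (K + 1) * (t * 4) ^ K := Nat.mul_le_mul_left _ (Nat.descFactorial_le_pow _ _)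

/-- `(t+1-K)^K · 8^K ≤ K! · |𝔉_K|` (`(t+1-K)^K ≤ t.descFactorial K = K! C(t,K)`). -/
theorem countGap_pow_le_factorial_mul_card (t K : ℕ) :
    (t + 1 - K) ^ K * 8 ^ K ≤ K.factorial * Fintype.card {s : Fin t → Option (Fin 4 × Bool) //
      (univ.filter fun b => (s b).isSome).card = K} := by
  calc (t + 1 - K) ^ K * 8 ^ K ≤ t.descFactorial K * 8 ^ K :=
        Nat.mul_le_mul_right _ (Nat.pow_sub_le_descFactorial t K)
    _ = K.factorial * (t.choose K * 8 ^ K) := by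
        rw [Nat.descFactorial_eq_factorial_mul_choose, Nat.mul_assoc]
    _ ≤ _ := Nat.mul_le_mul_left _ (countGap_choose_mul_pow_le_card t K)

/-! ## The numeric gap at `K = 2i`, `t = 8i` -/

/-- THE GAP at `t = 8i`, `K = 2i`: if `X (2i+1) < 2^i` then `X · D_K(4t) < |𝔉_K|`
(`K! X D_K(4t) ≤ X (2i+1) (32i)^(2i) < 2^i 1024^i i^(2i) ≤ 2304^i i^(2i) = (6i)^(2i) 8^(2i) ≤ K! |𝔉_K|`). -/
theorem countGap_gap {X i : ℕ} (hi : 0 < i) (hX : X * (2 * i + 1) < 2 ^ i) :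
    X * flatteningDeficiency (2 * i) (8 * i * 4) <
      Fintype.card {s : Fin (8 * i) → Option (Fin 4 × Bool) //
        (univ.filter fun b => (s b).isSome).card = 2 * i} := by
  have hpow1 : (8 * i * 4) ^ (2 * i) = 32 ^ (2 * i) * i ^ (2 * i) := by
    rw [← mul_pow]; congr 1; ring
  have hpow2 : (6 * i) ^ (2 * i) * 8 ^ (2 * i) = 48 ^ (2 * i) * i ^ (2 * i) := by
    rw [← mul_pow, ← mul_pow]; congr 1; ring
  have h2048 : 2 ^ i * 32 ^ (2 * i) ≤ 48 ^ (2 * i) := by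
    rw [pow_mul, pow_mul, ← mul_pow]
    exact Nat.pow_le_pow_left (by norm_num) i
  have hipos : 0 < i ^ (2 * i) := Nat.pow_pos hi
  have key : (2 * i).factorial * (X * flatteningDeficiency (2 * i) (8 * i * 4)) <
      (2 * i).factorial * Fintype.card {s : Fin (8 * i) → Option (Fin 4 × Bool) //
        (univ.filter fun b => (s b).isSome).card = 2 * i} :=
    calc (2 * i).factorial * (X * flatteningDeficiency (2 * i) (8 * i * 4))
        = X * ((2 * i).factorial * flatteningDeficiency (2 * i) (8 * i * 4)) := by ring
      _ ≤ X * ((2 * i + 1) * (8 * i * 4) ^ (2 * i)) :=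
          Nat.mul_le_mul_left _ (countGap_factorial_mul_deficiency_le (by omega))
      _ = X * (2 * i + 1) * 32 ^ (2 * i) * i ^ (2 * i) := by rw [hpow1]; ring
      _ < 2 ^ i * 32 ^ (2 * i) * i ^ (2 * i) :=
          Nat.mul_lt_mul_of_pos_right (Nat.mul_lt_mul_of_pos_right hX (by positivity)) hipos
      _ ≤ 48 ^ (2 * i) * i ^ (2 * i) := Nat.mul_le_mul_right _ h2048
      _ = (6 * i) ^ (2 * i) * 8 ^ (2 * i) := hpow2.symm
      _ ≤ (8 * i + 1 - 2 * i) ^ (2 * i) * 8 ^ (2 * i) :=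
          Nat.mul_le_mul_right _ (Nat.pow_le_pow_left (by omega) _)
      _ ≤ _ := countGap_pow_le_factorial_mul_card (8 * i) (2 * i)
  exact Nat.lt_of_mul_lt_mul_left key

/-- EXPONENT BOOKKEEPING: with `a = 2c + 10`, `(a+3) c + a + 4 ≤ 2^a`
(`≤ 2 (c+7)(c+1) < 2 · 2^(c+7) · 2^(c+1) = 2^(2c+9)`). -/
theorem countGap_exp_le (c : ℕ) :
    (2 * c + 10 + 3) * c + (2 * c + 10) + 4 ≤ 2 ^ (2 * c + 10) := by
  have h1 : c + 7 < 2 ^ (c + 7) := Nat.lt_two_pow_self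
  have h2 : c + 1 < 2 ^ (c + 1) := Nat.lt_two_pow_self
  have h3 : (c + 7) * (c + 1) < 2 ^ (c + 7) * 2 ^ (c + 1) := Nat.mul_lt_mul_of_lt_of_lt h1 h2
  have h4 : (2 : ℕ) ^ (2 * c + 10) = 2 ^ (c + 7) * 2 ^ (c + 1) * 4 := by ring
  rw [h4]
  nlinarith [h3, Nat.zero_le (c * c)]

/-- THE NUMERIC INEQUALITY: if `(a+3) c + a + 4 ≤ 2^a` then, with `i = 2^a` and `t = 8i`,
`2 (t^c + c) (2i + 1) < 2^i` (everything is a power of two: `t^c = 2^((a+3)c)`, `c < 2^((a+3)c)`,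
`2i + 1 < 2^(a+2)`). -/
theorem countGap_numeric {a c : ℕ} (hexp : (a + 3) * c + a + 4 ≤ 2 ^ a) :
    2 * ((8 * 2 ^ a) ^ c + c) * (2 * 2 ^ a + 1) < 2 ^ (2 ^ a) := by
  have h8 : (8 * 2 ^ a) ^ c = 2 ^ ((a + 3) * c) := by
    rw [pow_mul, pow_add]; ring
  have hc : c < 2 ^ ((a + 3) * c) :=
    Nat.lt_two_pow_self.trans_le
      (Nat.pow_le_pow_right (by norm_num) (Nat.le_mul_of_pos_left c (by omega)))
  have h1 : (8 * 2 ^ a) ^ c + c < 2 ^ ((a + 3) * c + 1) := by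
    rw [h8, pow_succ]; omega
  have h2 : 2 * 2 ^ a + 1 < 2 ^ (a + 2) := by
    have ha : 1 ≤ 2 ^ a := Nat.one_le_two_pow
    have : (2 : ℕ) ^ (a + 2) = 2 ^ a * 4 := by ring
    omega
  calc 2 * ((8 * 2 ^ a) ^ c + c) * (2 * 2 ^ a + 1)
      < 2 * 2 ^ ((a + 3) * c + 1) * 2 ^ (a + 2) :=
        Nat.mul_lt_mul_of_lt_of_lt (Nat.mul_lt_mul_of_pos_left h1 (by norm_num)) h2
    _ = 2 ^ ((a + 3) * c + a + 4) := by ring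
    _ ≤ 2 ^ (2 ^ a) := Nat.pow_le_pow_right (by norm_num) hexp

/-! ## The stub -/

/-- **stub_countGap** — COUNTING: the degree-`K` flat family (block patterns exciting exactly `K` of the
`t` blocks, `C(t,K)·8^K` of them) outnumbers the polynomially inflated deficiency budget:
for every `c` there are `t, K` (namely `t = 8i`, `K = 2i`, `i = 2^(2c+10)`) with
`2 (t^c + c) · D_K(4t) < |𝔉_K|`. -/
theorem stub_countGap :
    ∀ c : ℕ, ∃ t K : ℕ, 2 * (t ^ c + c) * flatteningDeficiency K (t * 4) <
      Fintype.card {s : Fin t → Option (Fin 4 × Bool) // (univ.filter fun b => (s b).isSome).card = K} := by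
  intro c
  exact ⟨8 * 2 ^ (2 * c + 10), 2 * 2 ^ (2 * c + 10),
    countGap_gap (Nat.two_pow_pos _) (countGap_numeric (countGap_exp_le c))⟩

end Summit.QuantumAdvantage.QuantumAdvantage.Theorems.SpinorFlattening
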